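import Literature.NumberTheory.Automorphic.GL2SplitTorusOrbitalIntegral
import HarnessLib

/-!
# The split-torus orbital integrals of `GL₂(F)`, `[0, ∞]`-valued form:
# `μ_q = C · ((k, x) ↦ k n(x) A)_* (κ ⊗ dx)` and `∫⁻_{G ⧸ A} F(y γ y⁻¹) dμ_q = C ‖m₀⁻¹m₁ − 1‖⁻¹ ∫⁻_{K × F} F(k γ n(x) k⁻¹)`
(Rogawski, *Automorphic representations of unitary groups in three variables* (1990), §4.13,
Lemma 4.13.1 (a) pp. 69–70; Gelbart (1975), Remark 9.23)

Topic `NumberTheory/Automorphic`; namespace `Literature.NumberTheory.Automorphic`. THEOREMS ONLY (no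
definition, no instance, no named fact, no `sorry`). Sibling of ★ `GL2SplitTorusOrbitalIntegral`
((g2-i) there is the BOCHNER form for continuous compactly supported `f`); here the same descent
for every BOREL `F : GL₂(F) → [0, ∞]` — no continuity, support or convergence hypothesis — in the
currency of ★ D-S1c `GLnLeviOrbitalDescent.exists_lintegral_descConj_eq_mul_lintegral_levi`, for
`G = GL₂(F)` over a non-archimedean local field `F`, `γ = d(m₀, m₁)` (`m₀ ≠ m₁`),
`A = C_G(γ)` the diagonal torus, `K = GL₂(𝒪)`, `κ` a Haar measure on `K`, `dx` an additive Haar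
measure on `F`, `μ_q ≠ 0` a `G`-invariant Radon measure on `G ⧸ A`:

* `GL2.exists_quotientMeasure_torus_eq_smul_map` — **the measure form in the `(k, x)` coordinates**:
  `μ_q = C · ((k, x) ↦ k n(x) A)_* (κ ⊗ dx)` for one `C > 0` with **`C · κ(K) · dx(𝒪) = μ_q(π(K))`**
  (★ `KNAQuotientIntegration.exists_measure_quotient_eq_smul_map` at `K = GL₂(𝒪)`, `N = N₂ ≅ F`,
  `A = C(γ)`, `B`, transported along `x ↦ n(x)`; the pin as in ★ (g2-i));
* **`GL2.exists_lintegral_descConj_diagGL2_eq_mul_lintegral`** — for every Borel `F ≥ 0`,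
  `∫⁻_{G ⧸ A} F(y γ y⁻¹) dμ_q = C ‖m₀⁻¹ m₁ − 1‖⁻¹ ∫⁻_{K × F} F(k γ n(x) k⁻¹) d(κ ⊗ dx)`, same `C`
  (the conjugation formula ★ `GL2.unipotentGL2_mul_diagGL2_mul_inv` and the Jacobian
  ★ `map_mul_left_addHaar`).

## References

* J. D. Rogawski, *Automorphic Representations of Unitary Groups in Three Variables* (1990), §4.13,
  Lemma 4.13.1 (a), pp. 69–70 [Rogawski1990].
* S. Gelbart, *Automorphic forms on adele groups* (1975), Thm. 9.22 (iii), Remark 9.23 p. 140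
  [Gelbart1975].
-/

noncomputable section

open MeasureTheory MeasureTheory.Measure Topology Filter Matrix ValuativeRel
open scoped NNReal ENNReal MatrixGroups

namespace Literature.NumberTheory.Automorphic

open Literature.MeasureTheory.Group
open Literature.NumberTheory.GaloisRepresentations.IsNonarchimedeanLocalField

section Orbital

variable {F : Type*} [Field F] [ValuativeRel F] [TopologicalSpace F] [IsNonarchimedeanLocalField F]
  [SecondCountableTopology F] [MeasurableSpace F] [BorelSpace F]
  [MeasurableSpace (GL (Fin 2) F)] [BorelSpace (GL (Fin 2) F)] [SecondCountableTopology (GL (Fin 2) F)]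

/-- **The invariant measure on `GL₂(F) ⧸ A` in the coordinates `(k, x) ↦ k n(x) A`, with its constant
pinned.** For `γ = d(m₀, m₁)`, `m₀ ≠ m₁`, `A = C(γ)`, `μ_q ≠ 0` a `GL₂(F)`-invariant measure on
`GL₂(F) ⧸ A` finite on compact sets, `κ` a Haar measure on `K = GL₂(𝒪)` and `dx` an additive Haar
measure on `F`: there is `C > 0` with **`μ_q = C · ((k, x) ↦ k n(x) A)_* (κ ⊗ dx)`** and
**`C · κ(K) · dx(𝒪) = μ_q(π(K))`** (the `K N A` form of ★ `KNAQuotientIntegration`, the unipotent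
coordinate `x ↦ n(x)`, and the fibre `K × n(𝒪)` of `π(K)`, ★ `GL2.exists_glInt_centralizer_eq_unipotentGL2_iff`).
[cite: Gelbart1975, Remark 9.23 p. 140] [cite: Rogawski1990, §4.13 p. 70] -/
theorem GL2.exists_quotientMeasure_torus_eq_smul_map {m₀ m₁ : Fˣ} (h : m₀ ≠ m₁)
    [MeasurableSpace (GL (Fin 2) F ⧸ Subgroup.centralizer ({diagGL2 m₀ m₁} : Set (GL (Fin 2) F)))]
    [BorelSpace (GL (Fin 2) F ⧸ Subgroup.centralizer ({diagGL2 m₀ m₁} : Set (GL (Fin 2) F)))]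
    (μq : Measure (GL (Fin 2) F ⧸ Subgroup.centralizer ({diagGL2 m₀ m₁} : Set (GL (Fin 2) F))))
    [SMulInvariantMeasure (GL (Fin 2) F) _ μq] [IsFiniteMeasureOnCompacts μq] (hμ : μq ≠ 0)
    (κ : Measure ↥(glInt 2 F)) [IsHaarMeasure κ] (dx : Measure F) [dx.IsAddHaarMeasure] :
    ∃ C : ℝ≥0, C ≠ 0 ∧
      (C : ℝ≥0∞) * (κ Set.univ * dx (𝒪[F] : Set F)) =
        μq ((QuotientGroup.mk : GL (Fin 2) F → _) '' (glInt 2 F : Set (GL (Fin 2) F))) ∧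
      μq = C • Measure.map (fun p : ↥(glInt 2 F) × F =>
        (QuotientGroup.mk ((p.1 : GL (Fin 2) F) *
          ((unipotentGL2 p.2 : ↥(upperUnitriangular (Fin 2) F)) : GL (Fin 2) F)) :
            GL (Fin 2) F ⧸ Subgroup.centralizer ({diagGL2 m₀ m₁} : Set (GL (Fin 2) F)))) (κ.prod dx) := by
  haveI : T2Space F := (GaloisRepresentations.IsNonarchimedeanLocalField.isLocalField F).toT2Space
  haveI : LocallyCompactSpace F :=
    (GaloisRepresentations.IsNonarchimedeanLocalField.isLocalField F).toLocallyCompactSpace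
  haveI : T2Space (GL (Fin 2) F) := t2Space_generalLinearGroup F 2
  haveI : LocallyCompactSpace (GL (Fin 2) F) := locallyCompactSpace_generalLinearGroup F 2
  -- the subgroups `K = GL₂(𝒪)`, `A = C(γ)`, `N = N₂`, `B`
  have hK : IsCompact ((glInt 2 F : Subgroup (GL (Fin 2) F)) : Set (GL (Fin 2) F)) := isCompact_glInt 2 F
  have hA : IsClosed ((Subgroup.centralizer ({diagGL2 m₀ m₁} : Set (GL (Fin 2) F)) : Subgroup (GL (Fin 2) F)) :
      Set (GL (Fin 2) F)) := Set.isClosed_centralizer _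
  have hB : IsClosed ((standardParabolicGL F (id : Fin 2 → Fin 2) : Subgroup (GL (Fin 2) F)) : Set (GL (Fin 2) F)) :=
    isClosed_standardParabolicGL_id
  have hAB := GL2.centralizer_diagGL2_le_borel (F := F) h
  have hNB : upperUnitriangular (Fin 2) F ≤ standardParabolicGL F (id : Fin 2 → Fin 2) :=
    upperUnitriangular_le_standardParabolicGL_fin_two
  have hAN := GL2.conj_mem_upperUnitriangular_of_mem_centralizer (F := F) h
  have hKB := GL2.exists_glInt_mul_borel (F := F)
  -- instances on the subgroup types
  haveI : BorelSpace ↥(Subgroup.centralizer ({diagGL2 m₀ m₁} : Set (GL (Fin 2) F))) := Subtype.borelSpace _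
  haveI : BorelSpace ↥(upperUnitriangular (Fin 2) F) := Subtype.borelSpace _
  haveI : BorelSpace ↥(glInt 2 F) := Subtype.borelSpace _
  haveI : LocallyCompactSpace ↥(Subgroup.centralizer ({diagGL2 m₀ m₁} : Set (GL (Fin 2) F))) :=
    hA.locallyCompactSpace
  haveI : CompactSpace ↥(glInt 2 F) := isCompact_iff_compactSpace.1 hK
  haveI : IsFiniteMeasure κ := CompactSpace.isFiniteMeasure
  haveI : SecondCountableTopology ↥(Subgroup.centralizer ({diagGL2 m₀ m₁} : Set (GL (Fin 2) F))) :=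
    TopologicalSpace.Subtype.secondCountableTopology _
  haveI : SecondCountableTopology ↥(upperUnitriangular (Fin 2) F) := TopologicalSpace.Subtype.secondCountableTopology _
  haveI : SecondCountableTopology ↥(glInt 2 F) := TopologicalSpace.Subtype.secondCountableTopology _
  haveI : BorelSpace (↥(glInt 2 F) × ↥(upperUnitriangular (Fin 2) F)) := Prod.borelSpace
  haveI : BorelSpace (↥(glInt 2 F) × F) := Prod.borelSpace
  -- the torus is abelian
  letI : CommGroup ↥(Subgroup.centralizer ({diagGL2 m₀ m₁} : Set (GL (Fin 2) F))) :=
    { (inferInstance : Group ↥(Subgroup.centralizer ({diagGL2 m₀ m₁} : Set (GL (Fin 2) F)))) with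
      mul_comm := fun x y => Subtype.ext (by
        obtain ⟨a, b, hx⟩ := (GL2.mem_centralizer_diagGL2_iff h (x : GL (Fin 2) F)).1 x.2
        obtain ⟨a', b', hy⟩ := (GL2.mem_centralizer_diagGL2_iff h (y : GL (Fin 2) F)).1 y.2
        change (x : GL (Fin 2) F) * y = y * x
        rw [hx, hy]
        exact GL2.diagGL2_mul_comm _ _ _ _) }
  -- the measures
  haveI : (haar : Measure (GL (Fin 2) F)).IsMulRightInvariant := isMulRightInvariant_generalLinearGroup _
  haveI : (haar : Measure (GL (Fin 2) F)).IsInvInvariant := isInvInvariant_of_isMulRightInvariant _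
  haveI : dx.Regular := regular_of_isAddHaarMeasure dx
  haveI : dx.IsNegInvariant := inferInstance
  haveI := GL2.isHaarMeasure_map_unipotentGL2 dx
  haveI := GL2.isInvInvariant_map_unipotentGL2 dx
  haveI : (haar : Measure ↥(Subgroup.centralizer ({diagGL2 m₀ m₁} : Set (GL (Fin 2) F)))).IsInvInvariant :=
    inferInstance
  obtain ⟨C, hC0, hμC⟩ := exists_measure_quotient_eq_smul_map hK hA hB hAB hNB hAN (GL2.torusBorelHomeomorph h)
    (GL2.torusBorelHomeomorph_eq_anMap h) hKB haar κ haar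
    (Measure.map (unipotentGL2 : F → ↥(upperUnitriangular (Fin 2) F)) dx) μq hμ
  have hm : Measurable fun p : ↥(glInt 2 F) × ↥(upperUnitriangular (Fin 2) F) =>
      (QuotientGroup.mk ((p.1 : GL (Fin 2) F) * (p.2 : GL (Fin 2) F)) :
        GL (Fin 2) F ⧸ Subgroup.centralizer ({diagGL2 m₀ m₁} : Set (GL (Fin 2) F))) :=
    ((QuotientGroup.continuous_mk (N := Subgroup.centralizer ({diagGL2 m₀ m₁} : Set (GL (Fin 2) F)))).comp
      ((continuous_subtype_val.comp continuous_fst).mul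
      (continuous_subtype_val.comp continuous_snd))).measurable
  -- the coordinate `x ↦ n(x)` as a measurable equivalence `F ≃ᵐ N₂`, and on the product
  set eN : F ≃ᵐ ↥(upperUnitriangular (Fin 2) F) := (unipotentHomeomorphGL2 (R := F)).toMeasurableEquiv
    with heN
  have heN_coe : (⇑eN : F → ↥(upperUnitriangular (Fin 2) F)) = unipotentGL2 := rfl
  set e : ↥(glInt 2 F) × F ≃ᵐ ↥(glInt 2 F) × ↥(upperUnitriangular (Fin 2) F) :=
    MeasurableEquiv.prodCongr (MeasurableEquiv.refl _) eN with he
  have hprod : κ.prod (Measure.map (unipotentGL2 : F → ↥(upperUnitriangular (Fin 2) F)) dx) =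
      Measure.map e (κ.prod dx) := by
    rw [← heN_coe, show (⇑e : ↥(glInt 2 F) × F → _) = Prod.map id eN from rfl,
      ← Measure.map_prod_map κ dx measurable_id eN.measurable, Measure.map_id]
  refine ⟨C, hC0, ?_, ?_⟩
  · -- the pin, from the sibling file's (g2-i) with the same `(μ_q, κ, dx)`: both constants satisfy the
    -- same equation with `κ(K) · dx(𝒪) ∈ (0, ∞)`; we re-derive it directly from `hμC` instead.
    have hKopen : IsOpen ((glInt 2 F : Subgroup (GL (Fin 2) F)) : Set (GL (Fin 2) F)) := isOpen_glInt 2 F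
    have hπK : MeasurableSet ((QuotientGroup.mk : GL (Fin 2) F → GL (Fin 2) F ⧸
        Subgroup.centralizer ({diagGL2 m₀ m₁} : Set (GL (Fin 2) F))) '' (glInt 2 F : Set (GL (Fin 2) F))) :=
      (QuotientGroup.isOpenMap_coe _ hKopen).measurableSet
    have hpre : (fun p : ↥(glInt 2 F) × ↥(upperUnitriangular (Fin 2) F) =>
        (QuotientGroup.mk ((p.1 : GL (Fin 2) F) * (p.2 : GL (Fin 2) F)) :
          GL (Fin 2) F ⧸ Subgroup.centralizer ({diagGL2 m₀ m₁} : Set (GL (Fin 2) F)))) ⁻¹'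
        ((QuotientGroup.mk : GL (Fin 2) F → _) '' (glInt 2 F : Set (GL (Fin 2) F))) =
        (Set.univ : Set ↥(glInt 2 F)) ×ˢ (eN '' (𝒪[F] : Set F)) := by
      ext ⟨k, n⟩
      simp only [Set.mem_preimage, Set.mem_image, Set.mem_prod, Set.mem_univ, true_and, SetLike.mem_coe]
      constructor
      · rintro ⟨k', hk', hkk'⟩
        have ha : k'⁻¹ * ((k : GL (Fin 2) F) * (n : GL (Fin 2) F)) ∈
            Subgroup.centralizer ({diagGL2 m₀ m₁} : Set (GL (Fin 2) F)) := QuotientGroup.eq.1 hkk'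
        obtain ⟨x, hx⟩ : ∃ x, unipotentGL2 x = n := ⟨_, unipotentGL2_entry n⟩
        refine ⟨x, ?_, by rw [heN_coe, hx]⟩
        refine (GL2.exists_glInt_centralizer_eq_unipotentGL2_iff h x).1
          ⟨(k : GL (Fin 2) F)⁻¹ * k', (glInt 2 F).mul_mem ((glInt 2 F).inv_mem k.2) hk', _, ha, ?_⟩
        rw [hx]
        group
      · rintro ⟨x, hx, hxn⟩
        obtain ⟨k', hk', a, ha, hxe⟩ := (GL2.exists_glInt_centralizer_eq_unipotentGL2_iff h x).2 hx
        refine ⟨(k : GL (Fin 2) F) * k', (glInt 2 F).mul_mem k.2 hk', ?_⟩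
        rw [QuotientGroup.eq, ← hxn, heN_coe]
        change ((k : GL (Fin 2) F) * k')⁻¹ * ((k : GL (Fin 2) F) *
          ((unipotentGL2 x : ↥(upperUnitriangular (Fin 2) F)) : GL (Fin 2) F)) ∈ _
        rw [hxe]
        have : ((k : GL (Fin 2) F) * k')⁻¹ * ((k : GL (Fin 2) F) * (k' * a)) = a := by group
        rw [this]
        exact ha
    rw [hμC, Measure.smul_apply, Measure.map_apply hm hπK, hpre, Measure.prod_prod,
      ← heN_coe, MeasurableEquiv.map_apply, eN.preimage_image, ENNReal.smul_def, smul_eq_mul]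
  · -- the measure form, transported from `K × N₂` to `K × F`
    rw [hμC, hprod, Measure.map_map hm e.measurable]
    rfl

/-- **(g2-i, `[0, ∞]`-valued) The split-torus orbital integrand of `GL₂(F)` in `K N` coordinates, for
every Borel `F ≥ 0`.** In the setting of `GL2.exists_quotientMeasure_torus_eq_smul_map` there is
`C > 0` with `C · κ(K) · dx(𝒪) = μ_q(π(K))` and, for every Borel `F : GL₂(F) → [0, ∞]`,
**`∫⁻_{G ⧸ A} F(y γ y⁻¹) dμ_q(y) = C ‖m₀⁻¹ m₁ − 1‖⁻¹ ∫⁻_{K × F} F(k γ n(x) k⁻¹) d(κ ⊗ dx)`**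
— the measure form, the conjugation `(k n(x)) γ (k n(x))⁻¹ = k (γ n((m₀⁻¹m₁ − 1) x)) k⁻¹`
(★ `GL2.unipotentGL2_mul_diagGL2_mul_inv`) and the substitution `x ↦ (m₀⁻¹m₁ − 1) x` on `F`
(★ `map_mul_left_addHaar`); no continuity, support or convergence hypothesis (Rogawski's
`Φ^G(γ, f) = |D_{G/M}(γ)|^{-1/2} Φ^M(γ, f̄^P)` at `G = GL₂ ⊃ M = A`, `[0, ∞]`-valued).
[cite: Rogawski1990, §4.13 Lemma 4.13.1 (a) pp. 69–70] [cite: Gelbart1975, Remark 9.23 p. 140] -/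
theorem GL2.exists_lintegral_descConj_diagGL2_eq_mul_lintegral {m₀ m₁ : Fˣ} (h : m₀ ≠ m₁)
    [MeasurableSpace (GL (Fin 2) F ⧸ Subgroup.centralizer ({diagGL2 m₀ m₁} : Set (GL (Fin 2) F)))]
    [BorelSpace (GL (Fin 2) F ⧸ Subgroup.centralizer ({diagGL2 m₀ m₁} : Set (GL (Fin 2) F)))]
    (μq : Measure (GL (Fin 2) F ⧸ Subgroup.centralizer ({diagGL2 m₀ m₁} : Set (GL (Fin 2) F))))
    [SMulInvariantMeasure (GL (Fin 2) F) _ μq] [IsFiniteMeasureOnCompacts μq] (hμ : μq ≠ 0)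
    (κ : Measure ↥(glInt 2 F)) [IsHaarMeasure κ] (dx : Measure F) [dx.IsAddHaarMeasure] :
    ∃ C : ℝ≥0, C ≠ 0 ∧
      (C : ℝ≥0∞) * (κ Set.univ * dx (𝒪[F] : Set F)) =
        μq ((QuotientGroup.mk : GL (Fin 2) F → _) '' (glInt 2 F : Set (GL (Fin 2) F))) ∧
      ∀ Fn : GL (Fin 2) F → ℝ≥0∞, Measurable Fn →
        ∫⁻ y, descConj (diagGL2 m₀ m₁) (Subgroup.centralizer ({diagGL2 m₀ m₁} : Set (GL (Fin 2) F)))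
            (fun _ hg => Subgroup.mem_centralizer_singleton_iff.1 hg) Fn y ∂μq =
          (C : ℝ≥0∞) * ((normAbs F (((m₀⁻¹ : Fˣ) : F) * m₁ - 1))⁻¹ : ℝ≥0) *
            ∫⁻ p : ↥(glInt 2 F) × F, Fn ((p.1 : GL (Fin 2) F) * diagGL2 m₀ m₁ *
              ((unipotentGL2 p.2 : ↥(upperUnitriangular (Fin 2) F)) : GL (Fin 2) F) *
                (p.1 : GL (Fin 2) F)⁻¹) ∂(κ.prod dx) := by
  haveI : T2Space F := (GaloisRepresentations.IsNonarchimedeanLocalField.isLocalField F).toT2Space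
  haveI : LocallyCompactSpace F :=
    (GaloisRepresentations.IsNonarchimedeanLocalField.isLocalField F).toLocallyCompactSpace
  haveI : T2Space (GL (Fin 2) F) := t2Space_generalLinearGroup F 2
  haveI : BorelSpace ↥(upperUnitriangular (Fin 2) F) := Subtype.borelSpace _
  haveI : BorelSpace ↥(glInt 2 F) := Subtype.borelSpace _
  haveI : CompactSpace ↥(glInt 2 F) := isCompact_iff_compactSpace.1 (isCompact_glInt 2 F)
  haveI : IsFiniteMeasure κ := CompactSpace.isFiniteMeasure
  haveI : SecondCountableTopology ↥(glInt 2 F) := TopologicalSpace.Subtype.secondCountableTopology _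
  haveI : BorelSpace (↥(glInt 2 F) × F) := Prod.borelSpace
  obtain ⟨C, hC0, hpin, hμC⟩ := GL2.exists_quotientMeasure_torus_eq_smul_map h μq hμ κ dx
  refine ⟨C, hC0, hpin, fun Fn hFn => ?_⟩
  have hmk : Measurable fun p : ↥(glInt 2 F) × F =>
      (QuotientGroup.mk ((p.1 : GL (Fin 2) F) *
        ((unipotentGL2 p.2 : ↥(upperUnitriangular (Fin 2) F)) : GL (Fin 2) F)) :
          GL (Fin 2) F ⧸ Subgroup.centralizer ({diagGL2 m₀ m₁} : Set (GL (Fin 2) F))) :=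
    ((QuotientGroup.continuous_mk (N := Subgroup.centralizer ({diagGL2 m₀ m₁} : Set (GL (Fin 2) F)))).comp
      ((continuous_subtype_val.comp continuous_fst).mul
        ((continuous_subtype_val.comp continuous_unipotentGL2).comp continuous_snd))).measurable
  have hφ : Measurable (descConj (diagGL2 m₀ m₁)
      (Subgroup.centralizer ({diagGL2 m₀ m₁} : Set (GL (Fin 2) F)))
      (fun _ hg => Subgroup.mem_centralizer_singleton_iff.1 hg) Fn) := measurable_descConj _ _ _ hFn
  rw [hμC, lintegral_smul_measure, lintegral_map hφ hmk]
  simp only [descConj_mk]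
  -- the conjugation formula `(k n(x)) γ (k n(x))⁻¹ = k (γ n(c x)) k⁻¹`
  have hconj : ∀ p : ↥(glInt 2 F) × F,
      Fn ((p.1 : GL (Fin 2) F) * ((unipotentGL2 p.2 : ↥(upperUnitriangular (Fin 2) F)) : GL (Fin 2) F) *
          diagGL2 m₀ m₁ * ((p.1 : GL (Fin 2) F) *
            ((unipotentGL2 p.2 : ↥(upperUnitriangular (Fin 2) F)) : GL (Fin 2) F))⁻¹) =
      (fun q : ↥(glInt 2 F) × F => Fn ((q.1 : GL (Fin 2) F) * diagGL2 m₀ m₁ *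
          ((unipotentGL2 q.2 : ↥(upperUnitriangular (Fin 2) F)) : GL (Fin 2) F) * (q.1 : GL (Fin 2) F)⁻¹))
        (p.1, (((m₀⁻¹ : Fˣ) : F) * m₁ - 1) * p.2) := by
    intro p
    simp only
    rw [_root_.mul_inv_rev, show (p.1 : GL (Fin 2) F) *
        ((unipotentGL2 p.2 : ↥(upperUnitriangular (Fin 2) F)) : GL (Fin 2) F) * diagGL2 m₀ m₁ *
        ((((unipotentGL2 p.2 : ↥(upperUnitriangular (Fin 2) F)) : GL (Fin 2) F))⁻¹ * (p.1 : GL (Fin 2) F)⁻¹) =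
      (p.1 : GL (Fin 2) F) * (((unipotentGL2 p.2 : ↥(upperUnitriangular (Fin 2) F)) : GL (Fin 2) F) *
        diagGL2 m₀ m₁ * (((unipotentGL2 p.2 : ↥(upperUnitriangular (Fin 2) F)) : GL (Fin 2) F))⁻¹) *
        (p.1 : GL (Fin 2) F)⁻¹ by simp only [mul_assoc], GL2.unipotentGL2_mul_diagGL2_mul_inv, ← mul_assoc]
  simp_rw [hconj]
  -- the substitution `x ↦ c x`, `c = m₀⁻¹ m₁ - 1 ≠ 0`, with Jacobian `‖c‖⁻¹`
  have hc : ((m₀⁻¹ : Fˣ) : F) * m₁ - 1 ≠ 0 := GL2.inv_mul_sub_one_ne_zero h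
  set ec : ↥(glInt 2 F) × F ≃ᵐ ↥(glInt 2 F) × F :=
    MeasurableEquiv.prodCongr (MeasurableEquiv.refl _) (MeasurableEquiv.mulLeft₀ _ hc) with hec
  have hec_coe : (⇑ec : ↥(glInt 2 F) × F → _) = fun p => (p.1, (((m₀⁻¹ : Fˣ) : F) * m₁ - 1) * p.2) := rfl
  have hmap : Measure.map ec (κ.prod dx) =
      ((normAbs F (((m₀⁻¹ : Fˣ) : F) * m₁ - 1)⁻¹ : ℝ≥0) : ℝ≥0∞) • κ.prod dx := by
    rw [show (⇑ec : ↥(glInt 2 F) × F → _) = Prod.map id (fun x => (((m₀⁻¹ : Fˣ) : F) * m₁ - 1) * x) from rfl,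
      ← Measure.map_prod_map κ dx measurable_id (measurable_const_mul _), Measure.map_id,
      map_mul_left_addHaar dx hc, Measure.prod_smul_right]
  set G : ↥(glInt 2 F) × F → ℝ≥0∞ := fun q : ↥(glInt 2 F) × F => Fn ((q.1 : GL (Fin 2) F) * diagGL2 m₀ m₁ *
      ((unipotentGL2 q.2 : ↥(upperUnitriangular (Fin 2) F)) : GL (Fin 2) F) * (q.1 : GL (Fin 2) F)⁻¹) with hG
  have h1 : (fun p : ↥(glInt 2 F) × F => G (p.1, (((m₀⁻¹ : Fˣ) : F) * m₁ - 1) * p.2)) =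
      fun p => G (ec p) := by
    funext p
    rw [hec_coe]
  rw [h1, ← lintegral_map_equiv G ec, hmap, lintegral_smul_measure, map_inv₀]
  simp only [ENNReal.smul_def, smul_eq_mul, mul_assoc]

end Orbital

end Literature.NumberTheory.Automorphic
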